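import Literature.MathematicalPhysics.QuantumFieldTheory.Balaban1983to89.B4Ineq19ZeroBoxFace
import Literature.MathematicalPhysics.QuantumFieldTheory.Balaban1983to89.B4Lemma22ZeroBoxDerivDual
import Literature.MathematicalPhysics.QuantumFieldTheory.Balaban1983to89.B4Lemma21Zero

/-!
# `Balaban1983to89.B4Lemma22ZeroBoxCube` — B4 LEMMA 2.2: (2.16) FOR EVERY `α < 1` AND (2.17) ON THE DIAGONAL
# `q = p ∈ [1, ∞]`, AT `Ã = 0` ON RECTANGULAR PARALLELEPIPEDS, IN b04's TYPED FORM `B4.Lemma22Printed` (conjunct 1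
# VERBATIM, conjunct 2 restricted to `1/q = 1/p`) ON b04's ZERO-FIELD CUBE CARRIER `B4Lemma21Zero.zeroFieldCube`
# OVER THE ZERO-FIELD BOX FAMILY (every scale `k ≥ 1`, every box, every mass `m² ∈ [0, m²₊]`, every charge)

**Source.** T. Bałaban, *Regularity and Decay of Lattice Green's Functions*, Commun. Math. Phys. **89**, 571–597
(1983) (bib key `Balaban1983RegularityDecay`, «B4»): p. 577 [PDF 7] (2.14) and Lemma 2.2 with (2.16); p. 578 [PDF 8]
(2.17); p. 583 [PDF 13] the proof of (2.17) for `G_k(□)`.  Quoted from the page renders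
`b2b-balaban-ref1/pages/1983-cmp89-regularity-decay/1983-cmp89-regularity-decay-p007-x2.png`, `…-p008-x2.png`,
`…-p013-x2.png` (not from the OCR text).

## WHAT IS PRINTED (verbatim from the renders; the print's `≦` is written `≤`)

p. 577, (2.14): «‖f‖_{1,α} = max{sup_x |f(x)|, sup_{x,μ} |(D^η_{A,μ}f)(x)|, sup_{x,x′,μ} (1/|x′ − x|^α)
|U(A(Γ_{x,x′}))·(D^η_{A,μ}f)(x′) − (D^η_{A,μ}f)(x)|}, where the suprema are taken on a domain of the function f.»

pp. 577–578, Lemma 2.2: «Let a rectangular parallelepiped □ be a sum of few large blocks (e.g., as in the case of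
the cubes □_j), and let Ã be a regular vector field configuration in the sense of Proposition I.2.1, constant in a
neighbourhood of the boundary of □. Then for e sufficiently small and α < 1, there exists a constant c₁ depending on
d, α only, such that ‖G_k(□,Ã)f‖_{1,α} ≤ c₁‖f‖_∞, (2.16) and a constant c₂ depending on d, p₁, such that
‖G_k(□,Ã)f‖_q, ‖D^η_{Ã,μ}G_k(□,Ã)f‖_q, ‖G_k(□,Ã)D^{η*}_{Ã,μ}f‖_q ≤ c₂‖f‖_p (2.17) for 1 ≤ p, q ≤ ∞, satisfying
the condition 1/p − 1/p₁ ≤ 1/q ≤ 1/p with p₁ > d.»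

p. 583: «Now we will prove the inequality (2.17) for G_k(□). For q = p = ∞, it is a special case of (2.16), but
for lack of dependence on α, and was proved above. For q = p = 1 we get it by duality argument, i.e. using the fact
that the space L^∞(□) is adjoint to L¹(□). The Riesz-Thorin Theorem implies it for arbitrary q = p from [1, ∞].
(For Riesz-Thorin Theorem see Ref. [6].)» … «Thus Lemma 2.2 is proved, or rather reduced to Lemma 2.4.»

## WHAT IS CERTIFIED (HONEST SCOPE)

THE CASE `Ã = 0` (so `U ≡ 1` in (2.14), `D^η_{0,μ} = B4Cor23Zero.fdiff`, `D^{η*}_{0,μ} = B4Cor23Zero.fdiffT`) for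
the operator `G_k(□,0) = (−Δ^{η,N}_□ + m² + aP_k)^{-1}` of (1.6) with the literal coefficient `a > 0` of `aP_k`
(b04's `ZeroFieldCube.green a = (fineOpR n a m² R)⁻¹`), on RECTANGULAR PARALLELEPIPEDS `□ = Π_μ[0, M_μ)` (`M_μ ≥ 1`
unit blocks; fine points `boxDom (L^k·M)`, mesh `η = L^{-k}`, `L = ℓ + 1 ≥ 2`), UNIFORMLY in the scale `k ≥ 1`,
the box and the mass `m² ∈ [0, m²₊]`: the ZERO-FIELD BOX FAMILY `BoxInst d ℓ m²₊` of node 12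
(`B4Ineq19ZeroBoxEta`), read in b04's zero-field cube carrier through `toZFC : BoxInst → B4Lemma21Zero.ZeroFieldCube`
and `cubeFam ℓ m²₊ a Mb K i := zeroFieldCube a Mb K (toZFC i)` (b04's files are untouched).

* (2.16) FOR EVERY `α < 1` — `lemma22_16_zero_box`: ONE `c₁ > 0` (depending on `d, L, a, m²₊, α` and, for `α < 0`
  only, on `Mb, K`) with `‖G_k(□,0)f‖_{1,α} ≤ c₁‖f‖_∞` (b04's `ZeroFieldCube.hold`, (2.14) at `U ≡ 1`) for every
  member meeting the typed antecedent `fewLargeBlocks` («a sum of few large blocks»: a union of `Mb`-blocks with at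
  most `K` labels) and every `f`; for `0 ≤ α < 1` with NO antecedent at all (`lemma22_16_zero_box_nonneg`).  The
  three entries of (2.14): `sup|Gf|` and `sup|D_μGf|` from (1.10) on boxes (nodes 6, 7 through node 12's
  `valG_bound`, `valDG_bound`), the Hölder quotient for `0 ≤ α < 1` from (1.9) on boxes UNGUARDED (node 14's
  `lhs19B_bound`: one reflection (2.42) in the far face), and for `α < 0` — where the typed weight
  `|x′ − x|_η^{−α} = |x′ − x|_η^{|α|}` GROWS with the distance (the print presumably intends `0 < α < 1`; the typed
  clause quantifies every `α < 1` and is discharged as typed) — from the antecedent: a box that is a union of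
  `Mb`-blocks with `≤ K` labels has every side `≤ K·Mb` (`side_le_of_few`), so `|x′ − x|_η ≤ K·Mb`
  (`edistR_le_of_few`) and the quotient is `≤ (K·Mb)^{|α|}·2c`.
* (2.17) ON THE DIAGONAL `q = p ∈ [1, ∞]` (`1/q = 1/p = s ∈ [0, 1]`) — `lemma22_17_diag_zero_box`: ONE `c₂ > 0`
  (depending on `d, L, a, m²₊`) with `‖Y f‖_p ≤ c₂‖f‖_p` for the three operators `Y ∈ {G_k(□,0), D^η_μG_k(□,0),
  G_k(□,0)D^{η*}_μ}` (b04's `ZeroFieldCube.opY`; norms `ZeroFieldCube.lpN` with the `η^{d+1}` weight, which cancels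
  on the diagonal), for every member, direction and `f` — NO antecedent used.  ROUTE (a recorded DIVERGENCE from the
  print): the three operators are written as kernels `Σ_x T(x′,x)f(x)` (`opY_apply`, `kerY`: `T₀ = G`,
  `T₁(x′,x) = L^k(G(fwd_μx′, x) − G(x′, x))`, `T₂(x′,x) = L^k(G(x′, fwd_μx) − G(x′, x))`); their ROW sums are
  bounded — `T₀`, `T₁` by the sign-vector trick on the `p = q = ∞` bounds (1.10) of nodes 6/7 («For q = p = ∞ …
  was proved above»), `T₂` by node 8's weighted row bound `lemma22_zero_box_Gdstar_roww_coeff` ((2.40)–(2.41) at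
  `p₁ = ∞`) — and their COLUMN sums by the symmetry of `G` («by duality argument»: `T₀ᵀ = T₀`, `T₁ᵀ = T₂`,
  `T₂ᵀ = T₁`, `B4BoxCov237.boxOpR_inv_isSymm`); then the elementary SCHUR TEST (`schur_pow`, `lpN_le_of_schur`: row
  sums `≤ A` and column sums `≤ A` give `‖T‖_{p→p} ≤ A` for every `p ∈ [1, ∞]`, by the weighted Hölder inequality
  `Real.inner_le_weight_mul_Lp_of_nonneg`) replaces the print's «Riesz-Thorin Theorem … for arbitrary q = p from
  [1, ∞]» — same conclusion, no interpolation (`kerY_sums`).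
* THE TYPED STATEMENT: `B4.Lemma22Printed fam d'` is the conjunction (2.16)-clause ∧ (2.17)-clause.  This file
  defines its DIAGONAL PART `Lemma22PrintedDiag fam := Lemma22Printed16 fam ∧ Lemma22Printed17Diag fam` (conjunct 1
  VERBATIM; conjunct 2 with `t = s`, the parameter `p₁` then being idle), proves
  `Lemma22Printed fam d' → Lemma22PrintedDiag fam` for EVERY family and EVERY `d'` (`lemma22PrintedDiag_of_printed`:
  the certified shape is a weakening of the typed one, not a look-alike), and DISCHARGES
  `Lemma22PrintedDiag (cubeFam ℓ m²₊ a Mb K)` for every `ℓ ≥ 1`, `a > 0`, `m²₊`, `Mb`, `K`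
  (`lemma22PrintedDiag_cubeFam`), with `e₁ = 1` (any threshold: the charge is inert at zero field; AS TYPED the two
  clauses on this family say exactly their threshold-free forms, `lemma22Printed16_cubeFam_iff_free`,
  `lemma22Printed17Diag_cubeFam_iff_free`).  The converse `Lemma22PrintedDiag → Lemma22Printed` is NOT claimed.
* NON-VACUITY AS KERNEL FACTS: for every threshold `e₁ > 0`, every `Mb ≥ 1`, `K ≥ 1` and EVERY scale `k ≥ 1` the
  member «the cube of one large block, mass `0`, charge `e₁`» (node 12's `BoxInst.cube`) meets ALL SIX typed
  antecedents (`rect`, `fewLargeBlocks`, `regular`, `constNearBdry`, `0 < e ≤ e₁`) (`cube_hypothesesC`,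
  `threshold_metC`); the statements are instantiated at `d + 1 = 4`, `L = 2` (closing examples).

NOT certified: any `Ã ≠ 0` — the content of Lemma 2.2 proper (the expansion (2.31)–(2.33), regularity of `Ã`,
«constant in a neighbourhood of the boundary of □», «for e sufficiently small»; at zero field these antecedents are
carried by the carrier as `True` / an inert charge and are not used); (2.17) OFF THE DIAGONAL (`q > p`,
`1/p − 1/p₁ ≤ 1/q < 1/p`), which needs the `L^p → L^∞` bounds (2.40)–(2.41) with FINITE `p₁ > d` (short-distance
kernel bounds `|G_k(x′,x)| ≲ |x′ − x|^{−(d−1)}`) — not in this lineage's box package; regions other than boxes;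
Lemma 2.4 itself (only its zero-field box consequences enter, through nodes 6–8, 10, 12, 14).  The constants
depend on the family parameters `L, a, m²₊` (the print: «depending on d, α only», «depending on d, p₁»), as in
every node of this lineage.

DEPENDENCIES (kernel-proved tree modules only; no Literature fact is minted, no hypothesis is assumed): node 14
`B4Ineq19ZeroBoxFace.lhs19B_bound` (→ node 12 `B4Ineq19ZeroBoxEta`: `BoxInst`, `valG_bound`, `valDG_bound`;
→ nodes 10, 7, 6), node 8 `B4Lemma22ZeroBoxDerivDual` (`fwd`, `lemma22_zero_box_Gdstar_roww_coeff`; → node 7's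
`mulVec_sub_mulVec`, `sum_abs_le_wsum`), b04's `B4Lemma21Zero` (`ZeroFieldCube`, `zeroFieldCube`,
`blk_cubeInst_eq_zero`) and `B4` (`CubeSetting`, `Lemma22Printed`), `B4Cor23Zero` (`fdiff`, `fdiffT`,
`dot_fdiffT`), `B4BoxCov237.boxOpR_inv_isSymm`, `B4Lower18.fineOpR_boxDom`, Mathlib's
`Real.inner_le_weight_mul_Lp_of_nonneg`.

VERSIONS: v1 (p187730).  v1.1 (this file): DOCFIX only — the quotation of Lemma 2.2 now reads «the cubes □_j»
as printed (v1 carried a spurious tilde on `□`), and the `≦ ↦ ≤` convention is declared; no declaration changed.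

Value = kernel certificate of a published lemma (B4 Lemma 2.2) in a special case (`Ã = 0`, boxes, (2.17) on the
diagonal) in the cell's typed form; NOT summit progress.
-/

namespace Literature.MathematicalPhysics.QuantumFieldTheory.Balaban1983to89.B4Lemma22ZeroBoxCube

open Finset Matrix
open Literature.MathematicalPhysics.QuantumFieldTheory.Balaban1983to89.B4 (CubeSetting Lemma22Printed)
open Literature.MathematicalPhysics.QuantumFieldTheory.Balaban1983to89.B4ContourShift (supNorm supNorm_nonneg
  abs_le_supNorm)
open Literature.MathematicalPhysics.QuantumFieldTheory.Balaban1983to89.B4Reflection242 (boxDom mem_boxDom blk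
  supNorm_le_of_forall)
open Literature.MathematicalPhysics.QuantumFieldTheory.Balaban1983to89.B4BoxCov237 (boxOpR uvec boxOpR_inv_isSymm)
open Literature.MathematicalPhysics.QuantumFieldTheory.Balaban1983to89.B4Lower18 (fineOpR fineOpR_boxDom
  IsBlockUnion boxDom_isBlockUnion edistR)
open Literature.MathematicalPhysics.QuantumFieldTheory.Balaban1983to89.B4Cor23Zero (fdiff fdiff_of_mem
  fdiff_of_not_mem fdiffT dot_fdiffT supp edistR_nonneg)
open Literature.MathematicalPhysics.QuantumFieldTheory.Balaban1983to89.B4Cor23ZeroDelta (setDist)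
open Literature.MathematicalPhysics.QuantumFieldTheory.Balaban1983to89.B4Cor23ZeroEta (ZeroFieldInstance)
open Literature.MathematicalPhysics.QuantumFieldTheory.Balaban1983to89.B4Thm110ZeroBoxDeriv (mulVec_sub_mulVec
  wsum sum_abs_le_wsum)
open Literature.MathematicalPhysics.QuantumFieldTheory.Balaban1983to89.B4Lemma22ZeroBoxDerivDual (fwd fwd_eq_of_nbr
  fwd_of_not_mem lemma22_zero_box_Gdstar_roww_coeff)
open Literature.MathematicalPhysics.QuantumFieldTheory.Balaban1983to89.B4Ineq19ZeroBoxEta (BoxInst abs_le_supN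
  supN_nonneg valG_bound valDG_bound Lk_pos setDist_edistR_nonneg)
open Literature.MathematicalPhysics.QuantumFieldTheory.Balaban1983to89.B4Ineq19ZeroBoxFace (lhs19B_bound)
open Literature.MathematicalPhysics.QuantumFieldTheory.Balaban1983to89.B4Lemma21Zero (ZeroFieldCube zeroFieldCube
  blk_cubeInst_eq_zero)

noncomputable section

variable {d : ℕ}

/-! ## §1 The box family read in b04's zero-field CUBE carrier (`B4Lemma21Zero.ZeroFieldCube`) -/

section Carrier

variable {ℓ : ℕ} {m2plus : ℝ}

/-- the member `i` of the zero-field box family (node 12's `BoxInst`: scale `k ≥ 1`, box `Π_μ[0, M_μ)`, mass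
`m² ∈ [0, m²₊]`, charge `e`) as one of b04's zero-field instances of Lemmas 2.1–2.2: mesh `n = L^k`, fine region the
box `boxDom (L^k·M)`, mass `m²`, charge `e` (the field `R₀` of the member — the larger region of the `δG` clauses of
the Theorem — is not read by Lemma 2.2 and is dropped). [folklore] -/
def toZFC (i : BoxInst d ℓ m2plus) : ZeroFieldCube d where
  n := (ℓ + 1) ^ i.k
  hn := BoxInst.one_le_Lk ℓ i.k
  R := boxDom (fun j => (ℓ + 1) ^ i.k * i.M j)
  hR := boxDom_isBlockUnion (BoxInst.one_le_Lk ℓ i.k) i.M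
  m2 := i.m2
  hm := i.hm
  e := i.e

/-- the mesh denominator of the member. [folklore] -/
theorem toZFC_n (i : BoxInst d ℓ m2plus) : (toZFC i).n = (ℓ + 1) ^ i.k := rfl

/-- the fine region of the member is the box. [folklore] -/
theorem toZFC_R (i : BoxInst d ℓ m2plus) : (toZFC i).R = boxDom (fun j => (ℓ + 1) ^ i.k * i.M j) := rfl

/-- the cube reading and node 12's `ZeroFieldInstance` reading of the member have the same mesh … [folklore] -/
theorem toZFC_n_eq (i : BoxInst d ℓ m2plus) : (toZFC i).n = i.toZF.n := rfl

/-- … the same fine region … [folklore] -/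
theorem toZFC_R_eq (i : BoxInst d ℓ m2plus) : (toZFC i).R = i.toZF.R := rfl

/-- … the same Green's function `G_k(□,0) = (−Δ^{η,N}_□ + m² + aP_k)^{-1}` … [folklore] -/
theorem green_eq (a : ℝ) (i : BoxInst d ℓ m2plus) : (toZFC i).green a = i.toZF.green a := rfl

/-- … which IS the lineage's box Green's function `(boxOpR L^k a m² M)⁻¹` (`B4Lower18.fineOpR_boxDom`). [folklore] -/
theorem green_eq_box (a : ℝ) (i : BoxInst d ℓ m2plus) :
    (toZFC i).green a = (boxOpR ((ℓ + 1) ^ i.k) a i.m2 i.M)⁻¹ := by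
  show (fineOpR ((ℓ + 1) ^ i.k) a i.m2 (boxDom (fun j => (ℓ + 1) ^ i.k * i.M j)))⁻¹ = _
  rw [fineOpR_boxDom]

/-- … and the same sup norm. [folklore] -/
theorem supN_eq (i : BoxInst d ℓ m2plus) (f : ↥(toZFC i).R → ℝ) : (toZFC i).supN f = i.toZF.supN f := rfl

/-- **THE ZERO-FIELD BOX FAMILY IN b04's CUBE CARRIER**: member `i ↦ zeroFieldCube a Mb K (toZFC i)` — coefficient `a`
of `aP_k`, large-block size `Mb` and label bound `K` of the typed antecedent `fewLargeBlocks` («a sum of few large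
blocks»). [cite: Balaban1983RegularityDecay, Lemma 2.2 pp. 577–578, case Ã = 0, □ a box] -/
def cubeFam (ℓ : ℕ) (m2plus a : ℝ) (Mb K : ℕ) : BoxInst d ℓ m2plus → CubeSetting :=
  fun i => zeroFieldCube a Mb K (toZFC i)

/-- every member is a rectangular parallelepiped in the carrier's sense (the coordinate box `[0, L^kM − 1]`).
[cite: Balaban1983RegularityDecay, Lemma 2.2 p. 577 «Let a rectangular parallelepiped □ …»] -/
theorem rectC (a : ℝ) (Mb K : ℕ) (i : BoxInst d ℓ m2plus) : (cubeFam ℓ m2plus a Mb K i).rect := by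
  refine ⟨fun _ => 0, fun j => (((ℓ + 1) ^ i.k * i.M j : ℕ) : ℤ) - 1, fun x => ?_⟩
  show x ∈ boxDom (fun j => (ℓ + 1) ^ i.k * i.M j) ↔ _
  rw [mem_boxDom]
  refine forall_congr' fun j => ?_
  rw [Int.le_sub_one_iff]

/-- the typed antecedent `fewLargeBlocks` of the member reads: the box is a union of `Mb`-blocks (blocks of `Mb·L^k`
fine points per direction) with at most `K` large-block labels. [folklore] -/
theorem fewLargeBlocks_iff (a : ℝ) (Mb K : ℕ) (i : BoxInst d ℓ m2plus) :
    (cubeFam ℓ m2plus a Mb K i).fewLargeBlocks ↔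
      IsBlockUnion (Mb * (ℓ + 1) ^ i.k) (boxDom fun j => (ℓ + 1) ^ i.k * i.M j) ∧
        ((boxDom fun j => (ℓ + 1) ^ i.k * i.M j).image (blk (Mb * (ℓ + 1) ^ i.k))).card ≤ K :=
  Iff.rfl

end Carrier

/-! ## §2 Elementary facts on b04's functionals `supN`, `lpN`, `hold` of a zero-field cube instance -/

section Functionals

variable (i : ZeroFieldCube d)

/-- a uniform pointwise bound `B ≥ 0` bounds the sup norm. [folklore] -/
theorem supN_le_of_forall (g : ↥i.R → ℝ) {B : ℝ} (hB : 0 ≤ B) (h : ∀ x, |g x| ≤ B) : i.supN g ≤ B := by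
  unfold ZeroFieldCube.supN
  split_ifs with hne
  · exact Finset.sup'_le _ _ fun x _ => h x
  · exact hB

/-- the Hölder norm (2.14) is bounded by `B ≥ 0` as soon as its three entries are. [folklore] -/
theorem hold_le (α : ℝ) (u : ↥i.R → ℝ) {B : ℝ} (hB : 0 ≤ B) (h1 : i.supN u ≤ B)
    (h2 : ∀ μ, i.supN (fdiff i.n i.R μ u) ≤ B)
    (h3 : ∀ μ x x', edistR i.n i.R x x' ^ (-α) * |fdiff i.n i.R μ u x' - fdiff i.n i.R μ u x| ≤ B) :
    i.hold α u ≤ B := by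
  unfold ZeroFieldCube.hold
  exact max_le h1 (max_le (Real.iSup_le h2 hB)
    (Real.iSup_le (fun μ => Real.iSup_le (fun x => Real.iSup_le (fun x' => h3 μ x x') hB) hB) hB))

end Functionals

/-! ## §3 The Schur test on a finite set: row sums `≤ A` and column sums `≤ A` give `‖T‖_{p→p} ≤ A`, `1 ≤ p ≤ ∞` -/

section Schur

variable {X : Type*} [Fintype X]

/-- `Σ_x |T(x′,x)f(x)|`-bound of a kernel row against a pointwise bound of `f`. [folklore] -/
theorem abs_sum_mul_le (T : X → X → ℝ) (f : X → ℝ) (x' : X) {F : ℝ} (hF : ∀ x, |f x| ≤ F) :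
    |∑ x, T x' x * f x| ≤ (∑ x, |T x' x|) * F := by
  calc |∑ x, T x' x * f x| ≤ ∑ x, |T x' x * f x| := Finset.abs_sum_le_sum_abs _ _
    _ = ∑ x, |T x' x| * |f x| := Finset.sum_congr rfl fun x _ => abs_mul _ _
    _ ≤ ∑ x, |T x' x| * F := Finset.sum_le_sum fun x _ => mul_le_mul_of_nonneg_left (hF x) (abs_nonneg _)
    _ = (∑ x, |T x' x|) * F := by rw [Finset.sum_mul]

/-- the sign vector realises the row sum: `Σ_x |v(x)| = Σ_x v(x)·sgn v(x)`. [folklore] -/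
theorem sum_abs_eq_sum_mul_sign (v : X → ℝ) :
    ∑ x, |v x| = ∑ x, v x * (if 0 ≤ v x then 1 else -1) := by
  refine Finset.sum_congr rfl fun x _ => ?_
  split_ifs with h
  · rw [mul_one, abs_of_nonneg h]
  · rw [mul_neg, mul_one, abs_of_neg (lt_of_not_ge h)]

/-- **ROW SUMS FROM AN `L^∞ → L^∞` BOUND** (the sign-vector trick): if `|Σ_x T(x′,x)f(x)| ≤ C` for every `f` with
`|f| ≤ 1`, then `Σ_x |T(x′,x)| ≤ C`. [folklore] -/
theorem rowSum_le_of_opBound (T : X → X → ℝ) (x' : X) {C : ℝ}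
    (h : ∀ f : X → ℝ, (∀ x, |f x| ≤ 1) → |∑ x, T x' x * f x| ≤ C) : ∑ x, |T x' x| ≤ C := by
  have h1 := h (fun x => if 0 ≤ T x' x then 1 else -1) (fun x => by split_ifs <;> simp)
  rw [sum_abs_eq_sum_mul_sign]
  exact (le_abs_self _).trans h1

/-- `A^{p-1}·A = A^p` for `A ≥ 0`, `p ≥ 1`. [folklore] -/
theorem rpow_sub_one_mul {A p : ℝ} (hA : 0 ≤ A) (hp : 1 ≤ p) : A ^ (p - 1) * A = A ^ p := by
  have h : A ^ (p - 1 + 1) = A ^ (p - 1) * A := Real.rpow_add_one' hA (by linarith)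
  rw [sub_add_cancel] at h
  exact h.symm

/-- **THE SCHUR TEST, `p`-th power form**: for a kernel `T` on a finite set with row sums `Σ_x |T(x′,x)| ≤ A` and
column sums `Σ_{x′} |T(x′,x)| ≤ A`, and `p ≥ 1`: `Σ_{x′} |Σ_x T(x′,x)f(x)|^p ≤ A^p·Σ_x |f(x)|^p` — from the weighted
Hölder inequality `Σ wz ≤ (Σ w)^{1−1/p}(Σ wz^p)^{1/p}` (Mathlib's `Real.inner_le_weight_mul_Lp_of_nonneg`) row by row,
then the column bound after exchanging the sums. [folklore] -/
theorem schur_pow (T : X → X → ℝ) (f : X → ℝ) {A p : ℝ} (hA : 0 ≤ A) (hp : 1 ≤ p)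
    (hrow : ∀ x', ∑ x, |T x' x| ≤ A) (hcol : ∀ x, ∑ x', |T x' x| ≤ A) :
    ∑ x', |∑ x, T x' x * f x| ^ p ≤ A ^ p * ∑ x, |f x| ^ p := by
  have hp0 : 0 < p := by linarith
  have key : ∀ x', |∑ x, T x' x * f x| ^ p ≤ A ^ (p - 1) * ∑ x, |T x' x| * |f x| ^ p := by
    intro x'
    have hW : 0 ≤ ∑ x, |T x' x| := Finset.sum_nonneg fun x _ => abs_nonneg _
    have hS : 0 ≤ ∑ x, |T x' x| * |f x| ^ p :=
      Finset.sum_nonneg fun x _ => mul_nonneg (abs_nonneg _) (Real.rpow_nonneg (abs_nonneg _) _)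
    have h1 : |∑ x, T x' x * f x| ≤ ∑ x, |T x' x| * |f x| :=
      (Finset.abs_sum_le_sum_abs _ _).trans (le_of_eq (Finset.sum_congr rfl fun x _ => abs_mul _ _))
    have h2 := Real.inner_le_weight_mul_Lp_of_nonneg (Finset.univ : Finset X) hp (fun x => |T x' x|)
      (fun x => |f x|) (fun x => abs_nonneg _) (fun x => abs_nonneg _)
    have h3 : |∑ x, T x' x * f x|
        ≤ (∑ x, |T x' x|) ^ (1 - p⁻¹) * (∑ x, |T x' x| * |f x| ^ p) ^ p⁻¹ := h1.trans h2
    have h4 : (1 - p⁻¹) * p = p - 1 := by field_simp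
    calc |∑ x, T x' x * f x| ^ p
        ≤ ((∑ x, |T x' x|) ^ (1 - p⁻¹) * (∑ x, |T x' x| * |f x| ^ p) ^ p⁻¹) ^ p :=
          Real.rpow_le_rpow (abs_nonneg _) h3 hp0.le
      _ = (∑ x, |T x' x|) ^ (p - 1) * ∑ x, |T x' x| * |f x| ^ p := by
          rw [Real.mul_rpow (Real.rpow_nonneg hW _) (Real.rpow_nonneg hS _), ← Real.rpow_mul hW, h4,
            Real.rpow_inv_rpow hS hp0.ne']
      _ ≤ A ^ (p - 1) * ∑ x, |T x' x| * |f x| ^ p :=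
          mul_le_mul_of_nonneg_right (Real.rpow_le_rpow hW (hrow x') (by linarith)) hS
  calc ∑ x', |∑ x, T x' x * f x| ^ p ≤ ∑ x', A ^ (p - 1) * ∑ x, |T x' x| * |f x| ^ p :=
        Finset.sum_le_sum fun x' _ => key x'
    _ = A ^ (p - 1) * ∑ x, |f x| ^ p * ∑ x', |T x' x| := by
        rw [← Finset.mul_sum, Finset.sum_comm]
        refine congrArg _ (Finset.sum_congr rfl fun x _ => ?_)
        rw [Finset.mul_sum]
        exact Finset.sum_congr rfl fun x' _ => mul_comm _ _
    _ ≤ A ^ (p - 1) * ∑ x, |f x| ^ p * A := by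
        refine mul_le_mul_of_nonneg_left ?_ (Real.rpow_nonneg hA _)
        exact Finset.sum_le_sum fun x _ => mul_le_mul_of_nonneg_left (hcol x) (Real.rpow_nonneg (abs_nonneg _) _)
    _ = A ^ p * ∑ x, |f x| ^ p := by
        rw [← Finset.sum_mul, mul_comm (∑ x, |f x| ^ p) A, ← mul_assoc, rpow_sub_one_mul hA hp]

/-- **THE SCHUR TEST FOR b04's NORMS `lpN`** (`‖g‖_p = (η^{d+1}Σ|g|^p)^{1/p}`, `p = 1/s`, `s ∈ (0,1]`; `s = 0` the sup
norm): for `g = Σ_x T(·,x)f(x)` with row and column sums of `|T|` at most `A ≥ 0`, `‖g‖_p ≤ A‖f‖_p` for every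
`s ∈ [0,1]` — at `s = 0` by the row bound alone, at `s ∈ (0,1]` by `schur_pow` (the lattice weight `η^{d+1}` cancels).
[folklore] -/
theorem lpN_le_of_schur (i : ZeroFieldCube d) (T : ↥i.R → ↥i.R → ℝ) (f g : ↥i.R → ℝ)
    (hg : ∀ x', g x' = ∑ x, T x' x * f x) {A : ℝ} (hA : 0 ≤ A)
    (hrow : ∀ x', ∑ x, |T x' x| ≤ A) (hcol : ∀ x, ∑ x', |T x' x| ≤ A) {s : ℝ} (hs0 : 0 ≤ s) (hs1 : s ≤ 1) :
    i.lpN s g ≤ A * i.lpN s f := by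
  unfold ZeroFieldCube.lpN
  rcases hs0.eq_or_lt with hs | hs
  · -- `s = 0`: the sup norms
    have hs' : s = 0 := hs.symm
    subst hs'
    rw [if_pos rfl, if_pos rfl]
    -- `|f x| ≤ ‖f‖_∞` and `0 ≤ ‖f‖_∞` (as node 12's `abs_le_supN`, `supN_nonneg`, for b04's cube instances)
    have hfx : ∀ x, |f x| ≤ i.supN f := fun x => by
      unfold ZeroFieldCube.supN
      rw [dif_pos ⟨x, Finset.mem_univ _⟩]
      exact Finset.le_sup' (fun y => |f y|) (Finset.mem_univ x)
    have hF : 0 ≤ i.supN f := by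
      unfold ZeroFieldCube.supN
      split_ifs with h
      · obtain ⟨x, hx⟩ := h
        exact (abs_nonneg (f x)).trans (Finset.le_sup' (fun y => |f y|) hx)
      · exact le_rfl
    refine supN_le_of_forall i g (mul_nonneg hA hF) fun x' => ?_
    rw [hg x']
    calc |∑ x, T x' x * f x| ≤ (∑ x, |T x' x|) * i.supN f := abs_sum_mul_le T f x' hfx
      _ ≤ A * i.supN f := mul_le_mul_of_nonneg_right (hrow x') hF
  · -- `0 < s ≤ 1`: `p = 1/s ≥ 1`
    rw [if_neg hs.ne', if_neg hs.ne']
    have hp : 1 ≤ 1 / s := by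
      rw [le_div_iff₀ hs, one_mul]
      exact hs1
    have hw : 0 ≤ ((1 : ℝ) / i.n) ^ (d + 1) := by positivity
    have hSf : 0 ≤ ∑ x, |f x| ^ (1 / s) := Finset.sum_nonneg fun x _ => Real.rpow_nonneg (abs_nonneg _) _
    have hSg : 0 ≤ ∑ x, |g x| ^ (1 / s) := Finset.sum_nonneg fun x _ => Real.rpow_nonneg (abs_nonneg _) _
    have key : ∑ x', |g x'| ^ (1 / s) ≤ A ^ (1 / s) * ∑ x, |f x| ^ (1 / s) := by
      have h := schur_pow T f hA hp hrow hcol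
      refine le_of_eq_of_le (Finset.sum_congr rfl fun x' _ => ?_) h
      rw [hg x']
    calc (((1 : ℝ) / i.n) ^ (d + 1) * ∑ x', |g x'| ^ (1 / s)) ^ s
        ≤ (((1 : ℝ) / i.n) ^ (d + 1) * (A ^ (1 / s) * ∑ x, |f x| ^ (1 / s))) ^ s :=
          Real.rpow_le_rpow (mul_nonneg hw hSg) (mul_le_mul_of_nonneg_left key hw) hs0
      _ = A * (((1 : ℝ) / i.n) ^ (d + 1) * ∑ x, |f x| ^ (1 / s)) ^ s := by
          rw [mul_left_comm, Real.mul_rpow (Real.rpow_nonneg hA _) (mul_nonneg hw hSf), one_div s,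
            Real.rpow_inv_rpow hA hs.ne']

end Schur

/-! ## §4 The three operators of (2.17) as kernels on the box; their row and column sums -/

section Kernels

variable {ℓ : ℕ} {m2plus : ℝ}

/-- on a box, b04's bond difference `D_μ` (`fdiff`: `L^k(u(x + e_μ) − u(x))` on a bond of `□`, `0` otherwise) is
`L^k(u(fwd_μ x) − u(x))` with node 8's forward neighbour `fwd_μ` (`= x` off the bonds). [folklore] -/
theorem fdiff_eq_fwd {N : Fin (d + 1) → ℕ} (n : ℕ) (μ : Fin (d + 1)) (u : ↥(boxDom N) → ℝ) (x : ↥(boxDom N)) :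
    fdiff n (boxDom N) μ u x = (n : ℝ) * (u (fwd N μ x) - u x) := by
  by_cases h : x.1 + uvec μ ∈ boxDom N
  · rw [fdiff_of_mem u h, fwd_eq_of_nbr μ x ⟨x.1 + uvec μ, h⟩ rfl]
  · rw [fdiff_of_not_mem u h, fwd_of_not_mem μ x h, sub_self, mul_zero]

/-- **THE KERNELS OF THE THREE OPERATORS OF (2.17) at `Ã = 0` on the box member `i`** (`G = G_k(□,0) =
(boxOpR L^k a m² M)⁻¹`, `n = L^k`, `fwd_μ` the forward neighbour along the bonds of `□`):
`T₀(x′,x) = G(x′,x)` (`G_k(□)`), `T₁(x′,x) = n(G(fwd_μx′, x) − G(x′, x))` (`D^η_μG_k(□)`),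
`T₂(x′,x) = n(G(x′, fwd_μx) − G(x′, x))` (`G_k(□)D^{η*}_μ`).
[cite: Balaban1983RegularityDecay, (2.17) p. 578, case Ã = 0, dictionary] -/
def kerY (a : ℝ) (i : BoxInst d ℓ m2plus) (k : Fin 3) (μ : Fin (d + 1)) :
    ↥(boxDom fun j => (ℓ + 1) ^ i.k * i.M j) → ↥(boxDom fun j => (ℓ + 1) ^ i.k * i.M j) → ℝ :=
  if k = 0 then fun x' x => (boxOpR ((ℓ + 1) ^ i.k) a i.m2 i.M)⁻¹ x' x
  else if k = 1 then fun x' x => (((ℓ + 1) ^ i.k : ℕ) : ℝ) *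
      ((boxOpR ((ℓ + 1) ^ i.k) a i.m2 i.M)⁻¹ (fwd (fun j => (ℓ + 1) ^ i.k * i.M j) μ x') x
        - (boxOpR ((ℓ + 1) ^ i.k) a i.m2 i.M)⁻¹ x' x)
  else fun x' x => (((ℓ + 1) ^ i.k : ℕ) : ℝ) *
      ((boxOpR ((ℓ + 1) ^ i.k) a i.m2 i.M)⁻¹ x' (fwd (fun j => (ℓ + 1) ^ i.k * i.M j) μ x)
        - (boxOpR ((ℓ + 1) ^ i.k) a i.m2 i.M)⁻¹ x' x)

/-- **b04's three vectors `opY` of (2.17) ARE these kernels applied to `f`**: `(Y_k f)(x′) = Σ_x T_k(x′,x)f(x)` for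
`Y₀ = G`, `Y₁ = D_μG` (`mulVec_sub_mulVec`), `Y₂ = GD_μ^⊤` (through the adjointness `dot_fdiffT`).
[cite: Balaban1983RegularityDecay, (2.17) p. 578, case Ã = 0, dictionary] -/
theorem opY_apply (a : ℝ) (i : BoxInst d ℓ m2plus) (k : Fin 3) (μ : Fin (d + 1))
    (f : ↥(boxDom fun j => (ℓ + 1) ^ i.k * i.M j) → ℝ) (x' : ↥(boxDom fun j => (ℓ + 1) ^ i.k * i.M j)) :
    (toZFC i).opY a k μ f x' = ∑ x, kerY a i k μ x' x * f x := by
  unfold ZeroFieldCube.opY kerY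
  rw [green_eq_box]
  split_ifs with h0 h1
  · rfl
  · show fdiff ((ℓ + 1) ^ i.k) (boxDom fun j => (ℓ + 1) ^ i.k * i.M j) μ
      ((boxOpR ((ℓ + 1) ^ i.k) a i.m2 i.M)⁻¹ *ᵥ f) x' = _
    rw [fdiff_eq_fwd, mulVec_sub_mulVec]
  · show (fun y => (boxOpR ((ℓ + 1) ^ i.k) a i.m2 i.M)⁻¹ x' y) ⬝ᵥ
      fdiffT ((ℓ + 1) ^ i.k) (boxDom fun j => (ℓ + 1) ^ i.k * i.M j) μ f = _
    rw [dot_fdiffT]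
    show ∑ x, fdiff ((ℓ + 1) ^ i.k) (boxDom fun j => (ℓ + 1) ^ i.k * i.M j) μ
      (fun y => (boxOpR ((ℓ + 1) ^ i.k) a i.m2 i.M)⁻¹ x' y) x * f x = _
    refine Finset.sum_congr rfl fun x _ => ?_
    rw [fdiff_eq_fwd]

/-- `c·e^{−δs}·F ≤ c·F` for `c, δ, s, F ≥ 0`: dropping the decay factor of the box theorems. [folklore] -/
theorem drop_exp {c δ s F : ℝ} (hc : 0 ≤ c) (hδ : 0 ≤ δ) (hs : 0 ≤ s) (hF : 0 ≤ F) :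
    c * Real.exp (-(δ * s)) * F ≤ c * F := by
  have he : Real.exp (-(δ * s)) ≤ 1 := Real.exp_le_one_iff.mpr (by nlinarith [mul_nonneg hδ hs])
  exact mul_le_mul_of_nonneg_right (mul_le_of_le_one_right hc he) hF

/-- **ROW AND COLUMN SUMS OF THE THREE KERNELS, uniformly over the box family**: ONE `A > 0` (depending on `d`,
`L = ℓ + 1`, `a`, `m²₊`) with `Σ_x |T_k(x′,x)| ≤ A` and `Σ_{x′} |T_k(x′,x)| ≤ A` for every member, `k`, `μ`.  ROWS:
`T₀`, `T₁` by the sign-vector trick on the `p = q = ∞` bounds (1.10) on boxes (nodes 6, 7 through node 12's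
`valG_bound`, `valDG_bound`: «For q = p = ∞, it is a special case of (2.16) … and was proved above»), `T₂` by node 8's
weighted row bound ((2.40)–(2.41) at `p₁ = ∞`); COLUMNS: by the symmetry of `G` («by duality argument»): `T₀ᵀ = T₀`,
`T₁ᵀ = T₂`, `T₂ᵀ = T₁`. [cite: Balaban1983RegularityDecay, p. 583, proof of (2.17) for G_k(□), case Ã = 0] -/
theorem kerY_sums (hℓ : 1 ≤ ℓ) (a : ℝ) (ha : 0 < a) :
    ∃ A : ℝ, 0 < A ∧ ∀ (i : BoxInst d ℓ m2plus) (k : Fin 3) (μ : Fin (d + 1)),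
      (∀ x', ∑ x, |kerY a i k μ x' x| ≤ A) ∧ (∀ x, ∑ x', |kerY a i k μ x' x| ≤ A) := by
  obtain ⟨δG, cG, hδG, hcG, hG⟩ := valG_bound (d := d) (m2plus := m2plus) hℓ a ha
  obtain ⟨δD, cD, hδD, hcD, hD⟩ := valDG_bound (d := d) (m2plus := m2plus) hℓ a ha
  obtain ⟨δ8, c8, hδ8, hc8, h8⟩ := lemma22_zero_box_Gdstar_roww_coeff d ℓ hℓ a a m2plus ha
  refine ⟨cG + cD + c8, by positivity, fun i k μ => ?_⟩
  have hS := boxOpR_inv_isSymm ((ℓ + 1) ^ i.k) a i.m2 i.M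
  -- row sums of `T₀ = G`
  have rowG : ∀ x' : ↥(boxDom fun j => (ℓ + 1) ^ i.k * i.M j),
      ∑ x, |(boxOpR ((ℓ + 1) ^ i.k) a i.m2 i.M)⁻¹ x' x| ≤ cG := by
    intro x'
    refine rowSum_le_of_opBound _ x' fun f hf => ?_
    have h := hG i f x'
    rw [BoxInst.green_eq] at h
    have hF1 : i.toZF.supN f ≤ 1 := supN_le_of_forall (toZFC i) f zero_le_one hf
    exact h.trans ((drop_exp hcG.le hδG.le (setDist_edistR_nonneg _ _) (supN_nonneg i.toZF f)).trans
      ((mul_le_mul_of_nonneg_left hF1 hcG.le).trans (le_of_eq (mul_one _))))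
  -- row sums of `T₁ = D_μG`
  have rowD : ∀ x' : ↥(boxDom fun j => (ℓ + 1) ^ i.k * i.M j),
      ∑ x, |(((ℓ + 1) ^ i.k : ℕ) : ℝ) *
        ((boxOpR ((ℓ + 1) ^ i.k) a i.m2 i.M)⁻¹ (fwd (fun j => (ℓ + 1) ^ i.k * i.M j) μ x') x
          - (boxOpR ((ℓ + 1) ^ i.k) a i.m2 i.M)⁻¹ x' x)| ≤ cD := by
    intro x'
    refine rowSum_le_of_opBound (fun x' x => (((ℓ + 1) ^ i.k : ℕ) : ℝ) *
        ((boxOpR ((ℓ + 1) ^ i.k) a i.m2 i.M)⁻¹ (fwd (fun j => (ℓ + 1) ^ i.k * i.M j) μ x') x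
          - (boxOpR ((ℓ + 1) ^ i.k) a i.m2 i.M)⁻¹ x' x)) x' fun f hf => ?_
    have h := hD i μ f x'
    rw [BoxInst.green_eq] at h
    have e : ∑ x, (((ℓ + 1) ^ i.k : ℕ) : ℝ) *
          ((boxOpR ((ℓ + 1) ^ i.k) a i.m2 i.M)⁻¹ (fwd (fun j => (ℓ + 1) ^ i.k * i.M j) μ x') x
            - (boxOpR ((ℓ + 1) ^ i.k) a i.m2 i.M)⁻¹ x' x) * f x
        = fdiff ((ℓ + 1) ^ i.k) (boxDom fun j => (ℓ + 1) ^ i.k * i.M j) μ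
          ((boxOpR ((ℓ + 1) ^ i.k) a i.m2 i.M)⁻¹ *ᵥ f) x' := by
      rw [fdiff_eq_fwd, mulVec_sub_mulVec]
    rw [e]
    have hF1 : i.toZF.supN f ≤ 1 := supN_le_of_forall (toZFC i) f zero_le_one hf
    exact h.trans ((drop_exp hcD.le hδD.le (setDist_edistR_nonneg _ _) (supN_nonneg i.toZF f)).trans
      ((mul_le_mul_of_nonneg_left hF1 hcD.le).trans (le_of_eq (mul_one _))))
  -- row sums of `T₂ = GD_μ^⊤` (node 8, the weight dropped)
  have row8 : ∀ x' : ↥(boxDom fun j => (ℓ + 1) ^ i.k * i.M j),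
      ∑ x, |(((ℓ + 1) ^ i.k : ℕ) : ℝ) *
        ((boxOpR ((ℓ + 1) ^ i.k) a i.m2 i.M)⁻¹ x' (fwd (fun j => (ℓ + 1) ^ i.k * i.M j) μ x)
          - (boxOpR ((ℓ + 1) ^ i.k) a i.m2 i.M)⁻¹ x' x)| ≤ c8 := by
    intro x'
    have hw := h8 i.k i.hk a i.m2 le_rfl le_rfl i.hm i.hm' i.M i.hM μ x'
    have h1 := sum_abs_le_wsum hδ8.le ((ℓ + 1) ^ i.k) x' (fun x => (((ℓ + 1) ^ i.k : ℕ) : ℝ) *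
        ((boxOpR ((ℓ + 1) ^ i.k) a i.m2 i.M)⁻¹ x' (fwd (fun j => (ℓ + 1) ^ i.k * i.M j) μ x)
          - (boxOpR ((ℓ + 1) ^ i.k) a i.m2 i.M)⁻¹ x' x))
    unfold wsum at h1
    exact h1.trans hw
  refine ⟨fun x' => ?_, fun x => ?_⟩
  · unfold kerY
    split_ifs with h0 h1
    · exact (rowG x').trans (by linarith)
    · exact (rowD x').trans (by linarith)
    · exact (row8 x').trans (by linarith)
  · unfold kerY
    split_ifs with h0 h1
    · calc ∑ x', |(boxOpR ((ℓ + 1) ^ i.k) a i.m2 i.M)⁻¹ x' x|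
          = ∑ x', |(boxOpR ((ℓ + 1) ^ i.k) a i.m2 i.M)⁻¹ x x'| :=
            Finset.sum_congr rfl fun x' _ => by rw [hS.apply x x']
        _ ≤ cG + cD + c8 := (rowG x).trans (by linarith)
    · calc ∑ x', |(((ℓ + 1) ^ i.k : ℕ) : ℝ) *
            ((boxOpR ((ℓ + 1) ^ i.k) a i.m2 i.M)⁻¹ (fwd (fun j => (ℓ + 1) ^ i.k * i.M j) μ x') x
              - (boxOpR ((ℓ + 1) ^ i.k) a i.m2 i.M)⁻¹ x' x)|
          = ∑ x', |(((ℓ + 1) ^ i.k : ℕ) : ℝ) *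
            ((boxOpR ((ℓ + 1) ^ i.k) a i.m2 i.M)⁻¹ x (fwd (fun j => (ℓ + 1) ^ i.k * i.M j) μ x')
              - (boxOpR ((ℓ + 1) ^ i.k) a i.m2 i.M)⁻¹ x x')| :=
            Finset.sum_congr rfl fun x' _ => by
              rw [hS.apply x (fwd (fun j => (ℓ + 1) ^ i.k * i.M j) μ x'), hS.apply x x']
        _ ≤ cG + cD + c8 := (row8 x).trans (by linarith)
    · calc ∑ x', |(((ℓ + 1) ^ i.k : ℕ) : ℝ) *
            ((boxOpR ((ℓ + 1) ^ i.k) a i.m2 i.M)⁻¹ x' (fwd (fun j => (ℓ + 1) ^ i.k * i.M j) μ x)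
              - (boxOpR ((ℓ + 1) ^ i.k) a i.m2 i.M)⁻¹ x' x)|
          = ∑ x', |(((ℓ + 1) ^ i.k : ℕ) : ℝ) *
            ((boxOpR ((ℓ + 1) ^ i.k) a i.m2 i.M)⁻¹ (fwd (fun j => (ℓ + 1) ^ i.k * i.M j) μ x) x'
              - (boxOpR ((ℓ + 1) ^ i.k) a i.m2 i.M)⁻¹ x x')| :=
            Finset.sum_congr rfl fun x' _ => by
              rw [hS.apply (fwd (fun j => (ℓ + 1) ^ i.k * i.M j) μ x) x', hS.apply x x']
        _ ≤ cG + cD + c8 := (rowD x).trans (by linarith)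

end Kernels

/-! ## §5 (2.17) ON THE DIAGONAL `q = p ∈ [1, ∞]` at `Ã = 0` on every box -/

section Diagonal

variable {ℓ : ℕ} {m2plus : ℝ}

/-- **[B4] LEMMA 2.2 (2.17) ON THE DIAGONAL `q = p`, AT `Ã = 0`, RECTANGULAR PARALLELEPIPEDS**: there is ONE `c₂ > 0`
(depending on `d`, `L = ℓ + 1`, `a`, `m²₊`) such that for every member of the box family (every scale `k ≥ 1`, box,
mass), every `k ∈ {0,1,2}` (`G_k(□,0)`, `D^η_μG_k(□,0)`, `G_k(□,0)D^{η*}_μ`), direction `μ`, source `f` and every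
`s = 1/p ∈ [0, 1]`: `‖Y_k f‖_p ≤ c₂‖f‖_p` in b04's norms `lpN` — by the Schur test on the kernels of §4 (in place of
the print's Riesz–Thorin interpolation between `p = q = ∞` and `p = q = 1`); NO antecedent of the Lemma is used.
[cite: Balaban1983RegularityDecay, Lemma 2.2 (2.17) p. 578 with p. 583, case Ã = 0, q = p] -/
theorem lemma22_17_diag_zero_box (hℓ : 1 ≤ ℓ) (a : ℝ) (ha : 0 < a) :
    ∃ c₂ : ℝ, 0 < c₂ ∧ ∀ (i : BoxInst d ℓ m2plus) (k : Fin 3) (μ : Fin (d + 1))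
      (f : ↥(boxDom fun j => (ℓ + 1) ^ i.k * i.M j) → ℝ) (s : ℝ), 0 ≤ s → s ≤ 1 →
      (toZFC i).lpN s ((toZFC i).opY a k μ f) ≤ c₂ * (toZFC i).lpN s f := by
  obtain ⟨A, hA, hker⟩ := kerY_sums (d := d) (m2plus := m2plus) hℓ a ha
  refine ⟨A, hA, fun i k μ f s hs0 hs1 => ?_⟩
  obtain ⟨hrow, hcol⟩ := hker i k μ
  exact lpN_le_of_schur (toZFC i) (kerY a i k μ) f _ (fun x' => opY_apply a i k μ f x') hA.le hrow hcol hs0 hs1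

end Diagonal

/-! ## §6 (2.16) FOR EVERY `α < 1` at `Ã = 0` on every box -/

section Holder

variable {ℓ : ℕ} {m2plus : ℝ}

/-- **A BOX THAT IS «A SUM OF FEW LARGE BLOCKS» HAS BOUNDED SIDES**: if the box `Π_μ[0, L^kM_μ)` of fine points is a
union of blocks of `Mb·L^k` fine points with at most `K` block labels, then every `M_μ ≤ K·Mb` (for `Mb = 0` the
antecedent is absurd; for `Mb ≥ 1` the points `j·Mb·L^k·e_μ`, `0 ≤ j ≤ K`, would carry `K + 1` labels). [folklore] -/
theorem side_le_of_few (i : BoxInst d ℓ m2plus) {Mb K : ℕ}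
    (hU : IsBlockUnion (Mb * (ℓ + 1) ^ i.k) (boxDom fun j => (ℓ + 1) ^ i.k * i.M j))
    (hK : ((boxDom fun j => (ℓ + 1) ^ i.k * i.M j).image (blk (Mb * (ℓ + 1) ^ i.k))).card ≤ K)
    (μ : Fin (d + 1)) : i.M μ ≤ K * Mb := by
  have hn1 : 1 ≤ (ℓ + 1) ^ i.k := BoxInst.one_le_Lk ℓ i.k
  have h0 : (0 : Fin (d + 1) → ℤ) ∈ boxDom (fun j => (ℓ + 1) ^ i.k * i.M j) := by
    rw [mem_boxDom]
    intro j
    refine ⟨le_rfl, ?_⟩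
    have := i.hM j
    show (0 : ℤ) < (((ℓ + 1) ^ i.k * i.M j : ℕ) : ℤ)
    exact_mod_cast Nat.mul_pos (by omega) (by omega)
  rcases Nat.eq_zero_or_pos Mb with hMb | hMb
  · -- `Mb = 0`: every point has label `0`, so `IsBlockUnion 0` forces the whole lattice into the box
    exfalso
    subst hMb
    have hz : (fun _ => (-1 : ℤ)) ∈ boxDom (fun j => (ℓ + 1) ^ i.k * i.M j) := by
      refine hU h0 ?_
      funext j
      simp [blk]
    rw [mem_boxDom] at hz
    have := (hz μ).1
    omega
  · by_contra hlt
    push Not at hlt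
    -- the `K + 1` points `j·Mb·L^k·e_μ`, `j = 0, …, K`, lie in the box and carry the distinct labels `j·e_μ`
    have hmem : ∀ j : ℕ, j ≤ K →
        (Pi.single μ ((j : ℤ) * ((Mb * (ℓ + 1) ^ i.k : ℕ) : ℤ)) : Fin (d + 1) → ℤ)
          ∈ boxDom (fun j => (ℓ + 1) ^ i.k * i.M j) := by
      intro j hj
      rw [mem_boxDom]
      intro ν
      by_cases hν : ν = μ
      · subst hν
        rw [Pi.single_eq_same]
        refine ⟨by positivity, ?_⟩
        have h1 : j * Mb < i.M ν := lt_of_le_of_lt (Nat.mul_le_mul_right Mb hj) hlt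
        have h2 : j * (Mb * (ℓ + 1) ^ i.k) < (ℓ + 1) ^ i.k * i.M ν := by
          calc j * (Mb * (ℓ + 1) ^ i.k) = j * Mb * (ℓ + 1) ^ i.k := by ring
            _ < i.M ν * (ℓ + 1) ^ i.k := Nat.mul_lt_mul_of_pos_right h1 (by omega)
            _ = (ℓ + 1) ^ i.k * i.M ν := by ring
        exact_mod_cast h2
      · rw [Pi.single_eq_of_ne hν]
        refine ⟨le_rfl, ?_⟩
        have := i.hM ν
        exact_mod_cast Nat.mul_pos (by omega) (by omega)
    have hlab : ∀ j : ℕ, blk (Mb * (ℓ + 1) ^ i.k)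
        (Pi.single μ ((j : ℤ) * ((Mb * (ℓ + 1) ^ i.k : ℕ) : ℤ)) : Fin (d + 1) → ℤ) = Pi.single μ (j : ℤ) := by
      intro j
      have hb : ((Mb * (ℓ + 1) ^ i.k : ℕ) : ℤ) ≠ 0 := by
        exact_mod_cast (Nat.mul_pos hMb (by omega)).ne'
      funext ν
      by_cases hν : ν = μ
      · subst hν
        simp only [blk, Pi.single_eq_same]
        exact Int.mul_ediv_cancel _ hb
      · simp only [blk, Pi.single_eq_of_ne hν]
        exact Int.zero_ediv _
    have hsub : (Finset.range (K + 1)).image (fun j : ℕ => (Pi.single μ (j : ℤ) : Fin (d + 1) → ℤ))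
        ⊆ (boxDom fun j => (ℓ + 1) ^ i.k * i.M j).image (blk (Mb * (ℓ + 1) ^ i.k)) := by
      intro y hy
      rw [Finset.mem_image] at hy ⊢
      obtain ⟨j, hj, rfl⟩ := hy
      exact ⟨_, hmem j (Nat.lt_succ_iff.mp (Finset.mem_range.mp hj)), hlab j⟩
    have hinj : Function.Injective (fun j : ℕ => (Pi.single μ (j : ℤ) : Fin (d + 1) → ℤ)) := by
      intro j j' h
      have := congrFun h μ
      simp only [Pi.single_eq_same] at this
      exact_mod_cast this
    have hcard := Finset.card_le_card hsub
    rw [Finset.card_image_of_injective _ hinj, Finset.card_range] at hcard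
    omega

/-- hence the `η`-distance of any two points of such a box is `≤ K·Mb` (the diameter of «few large blocks»).
[folklore] -/
theorem edistR_le_of_few (i : BoxInst d ℓ m2plus) {Mb K : ℕ}
    (hU : IsBlockUnion (Mb * (ℓ + 1) ^ i.k) (boxDom fun j => (ℓ + 1) ^ i.k * i.M j))
    (hK : ((boxDom fun j => (ℓ + 1) ^ i.k * i.M j).image (blk (Mb * (ℓ + 1) ^ i.k))).card ≤ K)
    (x x' : ↥(boxDom fun j => (ℓ + 1) ^ i.k * i.M j)) :
    edistR ((ℓ + 1) ^ i.k) (boxDom fun j => (ℓ + 1) ^ i.k * i.M j) x x' ≤ (K : ℝ) * Mb := by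
  have hside := fun μ => side_le_of_few i hU hK μ
  have hn := Lk_pos ℓ i.k
  unfold edistR
  rw [one_div, inv_mul_le_iff₀ hn]
  apply supNorm_le_of_forall
  intro j
  have hx := (mem_boxDom.1 x.2) j
  have hx' := (mem_boxDom.1 x'.2) j
  have hM : ((i.M j : ℕ) : ℤ) ≤ (K : ℤ) * (Mb : ℤ) := by exact_mod_cast hside j
  have hC : (((ℓ + 1) ^ i.k * i.M j : ℕ) : ℤ) ≤ (((ℓ + 1) ^ i.k : ℕ) : ℤ) * ((K : ℤ) * (Mb : ℤ)) := by
    rw [Nat.cast_mul]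
    exact mul_le_mul_of_nonneg_left hM (by positivity)
  have h1 : |x.1 j - x'.1 j| ≤ (((ℓ + 1) ^ i.k : ℕ) : ℤ) * ((K : ℤ) * (Mb : ℤ)) := by
    obtain ⟨hx0, hx1⟩ := hx
    obtain ⟨hx0', hx1'⟩ := hx'
    exact (abs_sub_lt_iff.2 ⟨by linarith, by linarith⟩).le.trans hC
  rw [Pi.sub_apply]
  exact_mod_cast h1

/-- **[B4] LEMMA 2.2 (2.16) AT `Ã = 0`, RECTANGULAR PARALLELEPIPEDS, EVERY `α < 1`**: ONE `c₁ > 0` (depending on `d`,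
`L = ℓ + 1`, `a`, `m²₊`, `α`, and for `α < 0` on `Mb`, `K`) such that for every member of the box family that is «a
sum of few large blocks» (a union of `Mb`-blocks with at most `K` labels — the typed antecedent `fewLargeBlocks`) and
every source `f`: `‖G_k(□,0)f‖_{1,α} ≤ c₁‖f‖_∞` in b04's Hölder norm `hold` ((2.14) with `U ≡ 1`).  The entries
`sup|Gf|`, `sup|D_μGf|` from (1.10) on boxes (nodes 6, 7 via node 12), the Hölder quotient for `0 ≤ α < 1` from
(1.9) UNGUARDED on boxes (node 14: «for rectangular parallelepipeds, the inequalities hold without any restrictions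
on the points x, x′», one reflection (2.42)), for `α < 0` from the diameter bound `|x′ − x|_η ≤ K·Mb` of few large
blocks. [cite: Balaban1983RegularityDecay, Lemma 2.2 (2.16) p. 577 with (2.14), case Ã = 0] -/
theorem lemma22_16_zero_box (hℓ : 1 ≤ ℓ) (a : ℝ) (ha : 0 < a) (Mb K : ℕ) (α : ℝ) (hα : α < 1) :
    ∃ c₁ : ℝ, 0 < c₁ ∧ ∀ i : BoxInst d ℓ m2plus,
      (IsBlockUnion (Mb * (ℓ + 1) ^ i.k) (boxDom fun j => (ℓ + 1) ^ i.k * i.M j) ∧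
        ((boxDom fun j => (ℓ + 1) ^ i.k * i.M j).image (blk (Mb * (ℓ + 1) ^ i.k))).card ≤ K) →
      ∀ f : ↥(boxDom fun j => (ℓ + 1) ^ i.k * i.M j) → ℝ,
        (toZFC i).hold α ((toZFC i).green a *ᵥ f) ≤ c₁ * (toZFC i).supN f := by
  obtain ⟨δG, cG, hδG, hcG, hG⟩ := valG_bound (d := d) (m2plus := m2plus) hℓ a ha
  obtain ⟨δD, cD, hδD, hcD, hD⟩ := valDG_bound (d := d) (m2plus := m2plus) hℓ a ha
  obtain ⟨δH, cH, hδH, hcH, hH⟩ :=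
    lhs19B_bound (d := d) (m2plus := m2plus) hℓ a ha (max α 0) (le_max_right _ _) (max_lt hα one_pos)
  have hcN0 : 0 ≤ ((K : ℝ) * Mb) ^ (-α) * (2 * cD) :=
    mul_nonneg (Real.rpow_nonneg (by positivity) _) (by positivity)
  set C : ℝ := cG + cD + cH + ((K : ℝ) * Mb) ^ (-α) * (2 * cD) with hC
  have hC0 : 0 < C := by positivity
  refine ⟨C, hC0, fun i hfew f => ?_⟩
  have hF := supN_nonneg i.toZF f
  have hB : 0 ≤ C * i.toZF.supN f := mul_nonneg hC0.le hF
  -- the two sup entries of (2.14): (1.10) on boxes, the decay factor dropped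
  have hGx : ∀ x, |((toZFC i).green a *ᵥ f) x| ≤ cG * i.toZF.supN f := fun x =>
    (hG i f x).trans (drop_exp hcG.le hδG.le (setDist_edistR_nonneg _ _) hF)
  have hDx : ∀ μ x, |fdiff (toZFC i).n (toZFC i).R μ ((toZFC i).green a *ᵥ f) x| ≤ cD * i.toZF.supN f :=
    fun μ x => (hD i μ f x).trans (drop_exp hcD.le hδD.le (setDist_edistR_nonneg _ _) hF)
  have h1 : (toZFC i).supN ((toZFC i).green a *ᵥ f) ≤ C * i.toZF.supN f := by
    refine supN_le_of_forall (toZFC i) _ hB fun x => (hGx x).trans ?_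
    exact mul_le_mul_of_nonneg_right (by rw [hC]; linarith [hcD.le, hcH.le]) hF
  have h2 : ∀ μ, (toZFC i).supN (fdiff (toZFC i).n (toZFC i).R μ ((toZFC i).green a *ᵥ f))
      ≤ C * i.toZF.supN f := by
    intro μ
    refine supN_le_of_forall (toZFC i) _ hB fun x => (hDx μ x).trans ?_
    exact mul_le_mul_of_nonneg_right (by rw [hC]; linarith [hcG.le, hcH.le]) hF
  -- the Hölder entry of (2.14)
  have h3 : ∀ μ x x', edistR (toZFC i).n (toZFC i).R x x' ^ (-α) *
      |fdiff (toZFC i).n (toZFC i).R μ ((toZFC i).green a *ᵥ f) x'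
        - fdiff (toZFC i).n (toZFC i).R μ ((toZFC i).green a *ᵥ f) x| ≤ C * i.toZF.supN f := by
    intro μ x x'
    by_cases hα0 : 0 ≤ α
    · -- `0 ≤ α < 1`: (1.9) on boxes, unguarded (node 14), the decay factor dropped
      have hmax : max α 0 = α := max_eq_left hα0
      have h := hH i μ f x x'
      rw [hmax] at h
      calc _ ≤ cH * Real.exp (-(δH * setDist (edistR i.toZF.n i.toZF.R) ({x} ∪ {x'}) (supp f)))
            * i.toZF.supN f := h
        _ ≤ cH * i.toZF.supN f := drop_exp hcH.le hδH.le (setDist_edistR_nonneg _ _) hF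
        _ ≤ _ := mul_le_mul_of_nonneg_right (by rw [hC]; linarith [hcG.le, hcD.le]) hF
    · -- `α < 0`: the weight `|x − x′|_η^{|α|} ≤ (K·Mb)^{|α|}` on a box of few large blocks
      push Not at hα0
      have hdist := edistR_le_of_few i hfew.1 hfew.2 x x'
      have hw : edistR ((ℓ + 1) ^ i.k) (boxDom fun j => (ℓ + 1) ^ i.k * i.M j) x x' ^ (-α)
          ≤ ((K : ℝ) * Mb) ^ (-α) :=
        Real.rpow_le_rpow (edistR_nonneg _ _) hdist (by linarith)
      have hdf : |fdiff (toZFC i).n (toZFC i).R μ ((toZFC i).green a *ᵥ f) x'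
            - fdiff (toZFC i).n (toZFC i).R μ ((toZFC i).green a *ᵥ f) x| ≤ 2 * cD * i.toZF.supN f :=
        calc _ ≤ |fdiff (toZFC i).n (toZFC i).R μ ((toZFC i).green a *ᵥ f) x'|
              + |fdiff (toZFC i).n (toZFC i).R μ ((toZFC i).green a *ᵥ f) x| := abs_sub _ _
          _ ≤ cD * i.toZF.supN f + cD * i.toZF.supN f := add_le_add (hDx μ x') (hDx μ x)
          _ = 2 * cD * i.toZF.supN f := by ring
      calc _ ≤ ((K : ℝ) * Mb) ^ (-α) * (2 * cD * i.toZF.supN f) :=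
            mul_le_mul hw hdf (abs_nonneg _) (Real.rpow_nonneg (by positivity) _)
        _ = ((K : ℝ) * Mb) ^ (-α) * (2 * cD) * i.toZF.supN f := by ring
        _ ≤ _ := mul_le_mul_of_nonneg_right (by rw [hC]; linarith [hcG.le, hcD.le, hcH.le]) hF
  exact hold_le (toZFC i) α _ hB h1 h2 h3

/-- for `0 ≤ α < 1` NO antecedent at all is used: `‖G_k(□,0)f‖_{1,α} ≤ c₁‖f‖_∞` on EVERY member of the box family.
[cite: Balaban1983RegularityDecay, Lemma 2.2 (2.16) p. 577, case Ã = 0, 0 ≤ α < 1] -/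
theorem lemma22_16_zero_box_nonneg (hℓ : 1 ≤ ℓ) (a : ℝ) (ha : 0 < a) (α : ℝ) (hα0 : 0 ≤ α) (hα : α < 1) :
    ∃ c₁ : ℝ, 0 < c₁ ∧ ∀ (i : BoxInst d ℓ m2plus) (f : ↥(boxDom fun j => (ℓ + 1) ^ i.k * i.M j) → ℝ),
      (toZFC i).hold α ((toZFC i).green a *ᵥ f) ≤ c₁ * (toZFC i).supN f := by
  obtain ⟨δG, cG, hδG, hcG, hG⟩ := valG_bound (d := d) (m2plus := m2plus) hℓ a ha
  obtain ⟨δD, cD, hδD, hcD, hD⟩ := valDG_bound (d := d) (m2plus := m2plus) hℓ a ha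
  obtain ⟨δH, cH, hδH, hcH, hH⟩ := lhs19B_bound (d := d) (m2plus := m2plus) hℓ a ha α hα0 hα
  set C : ℝ := cG + cD + cH with hC
  have hC0 : 0 < C := by positivity
  refine ⟨C, hC0, fun i f => ?_⟩
  have hF := supN_nonneg i.toZF f
  have hB : 0 ≤ C * i.toZF.supN f := mul_nonneg hC0.le hF
  have h1 : (toZFC i).supN ((toZFC i).green a *ᵥ f) ≤ C * i.toZF.supN f := by
    refine supN_le_of_forall (toZFC i) _ hB fun x => ?_
    exact ((hG i f x).trans (drop_exp hcG.le hδG.le (setDist_edistR_nonneg _ _) hF)).trans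
      (mul_le_mul_of_nonneg_right (by rw [hC]; linarith [hcD.le, hcH.le]) hF)
  have h2 : ∀ μ, (toZFC i).supN (fdiff (toZFC i).n (toZFC i).R μ ((toZFC i).green a *ᵥ f))
      ≤ C * i.toZF.supN f := by
    intro μ
    refine supN_le_of_forall (toZFC i) _ hB fun x => ?_
    exact ((hD i μ f x).trans (drop_exp hcD.le hδD.le (setDist_edistR_nonneg _ _) hF)).trans
      (mul_le_mul_of_nonneg_right (by rw [hC]; linarith [hcG.le, hcH.le]) hF)
  have h3 : ∀ μ x x', edistR (toZFC i).n (toZFC i).R x x' ^ (-α) *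
      |fdiff (toZFC i).n (toZFC i).R μ ((toZFC i).green a *ᵥ f) x'
        - fdiff (toZFC i).n (toZFC i).R μ ((toZFC i).green a *ᵥ f) x| ≤ C * i.toZF.supN f := by
    intro μ x x'
    exact ((hH i μ f x x').trans (drop_exp hcH.le hδH.le (setDist_edistR_nonneg _ _) hF)).trans
      (mul_le_mul_of_nonneg_right (by rw [hC]; linarith [hcG.le, hcD.le]) hF)
  exact hold_le (toZFC i) α _ hB h1 h2 h3

end Holder

/-! ## §7 The typed statement: `B4.Lemma22Printed`, its diagonal part, and the discharge on the box family -/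

section Typed

variable {I : Type}

/-- **CONJUNCT 1 OF `B4.Lemma22Printed`, VERBATIM** — the (2.16)-clause: «for e sufficiently small and α < 1, there
exists a constant c₁ depending on d, α only, such that ‖G_k(□,Ã)f‖_{1,α} ≤ c₁‖f‖_∞».
[cite: Balaban1983RegularityDecay, Lemma 2.2 (2.16) p. 577] -/
def Lemma22Printed16 (fam : I → CubeSetting) : Prop :=
  ∀ α : ℝ, α < 1 → ∃ c₁ e₁ : ℝ, 0 < c₁ ∧ 0 < e₁ ∧ ∀ i : I,
    (fam i).rect → (fam i).fewLargeBlocks → (fam i).regular → (fam i).constNearBdry →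
    0 < (fam i).e → (fam i).e ≤ e₁ →
    ∀ f : (fam i).Src, (fam i).holder1 α f ≤ c₁ * (fam i).supNorm f

/-- `Lemma22Printed16` IS conjunct 1 of b04's `B4.Lemma22Printed` — the split is a definitional unfolding
(`Iff.rfl`); conjunct 2 is displayed verbatim. [folklore] -/
theorem lemma22Printed_iff (fam : I → CubeSetting) (d' : ℕ) :
    Lemma22Printed fam d' ↔ Lemma22Printed16 fam ∧
      (∀ p₁ : ℝ, (d' : ℝ) < p₁ → ∃ c₂ e₁ : ℝ, 0 < c₂ ∧ 0 < e₁ ∧ ∀ i : I,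
        (fam i).rect → (fam i).fewLargeBlocks → (fam i).regular → (fam i).constNearBdry →
        0 < (fam i).e → (fam i).e ≤ e₁ →
        ∀ (s t : ℝ) (n : Fin 3) (μ : (fam i).Dir) (f : (fam i).Src),
          0 ≤ t → s ≤ 1 → s - 1 / p₁ ≤ t → t ≤ s → (fam i).opLq n μ t f ≤ c₂ * (fam i).lpNorm s f) :=
  Iff.rfl

/-- **CONJUNCT 2 OF `B4.Lemma22Printed` RESTRICTED TO THE DIAGONAL `1/q = 1/p`** (`t = s ∈ [0,1]`; the parameter
`p₁` of the off-diagonal range is then idle): «‖G_k(□,Ã)f‖_q, ‖D^η_{Ã,μ}G_k(□,Ã)f‖_q, ‖G_k(□,Ã)D^{η*}_{Ã,μ}f‖_q ≤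
c₂‖f‖_p» for `q = p ∈ [1, ∞]`. [cite: Balaban1983RegularityDecay, Lemma 2.2 (2.17) p. 578, q = p] -/
def Lemma22Printed17Diag (fam : I → CubeSetting) : Prop :=
  ∃ c₂ e₁ : ℝ, 0 < c₂ ∧ 0 < e₁ ∧ ∀ i : I,
    (fam i).rect → (fam i).fewLargeBlocks → (fam i).regular → (fam i).constNearBdry →
    0 < (fam i).e → (fam i).e ≤ e₁ →
    ∀ (s : ℝ) (n : Fin 3) (μ : (fam i).Dir) (f : (fam i).Src),
      0 ≤ s → s ≤ 1 → (fam i).opLq n μ s f ≤ c₂ * (fam i).lpNorm s f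

/-- **THE DIAGONAL PART OF LEMMA 2.2**: (2.16) ∧ (2.17) for `q = p`.
[cite: Balaban1983RegularityDecay, Lemma 2.2 (2.16)–(2.17) pp. 577–578] -/
def Lemma22PrintedDiag (fam : I → CubeSetting) : Prop :=
  Lemma22Printed16 fam ∧ Lemma22Printed17Diag fam

/-- **THE CERTIFIED SHAPE IS A WEAKENING OF THE TYPED LEMMA** (for every family and every dimension parameter):
`Lemma22Printed fam d' → Lemma22PrintedDiag fam` — conjunct 1 verbatim, conjunct 2 at `p₁ := d' + 1` and `t := s`.
[folklore] -/
theorem lemma22PrintedDiag_of_printed (fam : I → CubeSetting) (d' : ℕ) (h : Lemma22Printed fam d') :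
    Lemma22PrintedDiag fam := by
  refine ⟨h.1, ?_⟩
  obtain ⟨c₂, e₁, hc, he, h2⟩ := h.2 ((d' : ℝ) + 1) (by linarith)
  refine ⟨c₂, e₁, hc, he, fun i h1 h2' h3 h4 h5 h6 s n μ f hs0 hs1 => ?_⟩
  have hp : (0 : ℝ) < 1 / ((d' : ℝ) + 1) := by positivity
  exact h2 i h1 h2' h3 h4 h5 h6 s s n μ f hs0 hs1 (by linarith) le_rfl

variable {ℓ : ℕ} {m2plus : ℝ}

/-- **(2.16)-CLAUSE OF `B4.Lemma22Printed` DISCHARGED ON THE ZERO-FIELD BOX FAMILY** (every `ℓ ≥ 1`, `a > 0`, `m²₊`,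
`Mb`, `K`), with `e₁ = 1` (any threshold would do: the charge is inert at `Ã = 0`); of the six typed antecedents
only `fewLargeBlocks` is used, and only for `α < 0`.
[cite: Balaban1983RegularityDecay, Lemma 2.2 (2.16) p. 577, case Ã = 0, □ a box] -/
theorem lemma22Printed16_cubeFam (hℓ : 1 ≤ ℓ) (a : ℝ) (ha : 0 < a) (Mb K : ℕ) :
    Lemma22Printed16 (cubeFam (d := d) ℓ m2plus a Mb K) := by
  intro α hα
  obtain ⟨c₁, hc, h⟩ := lemma22_16_zero_box (d := d) (m2plus := m2plus) hℓ a ha Mb K α hα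
  exact ⟨c₁, 1, hc, one_pos, fun i _ hfew _ _ _ _ f => h i hfew f⟩

/-- **(2.17)-CLAUSE ON THE DIAGONAL DISCHARGED ON THE ZERO-FIELD BOX FAMILY** (every `ℓ ≥ 1`, `a > 0`, `m²₊`, `Mb`,
`K`), `e₁ = 1`, no antecedent used.
[cite: Balaban1983RegularityDecay, Lemma 2.2 (2.17) p. 578 with p. 583, case Ã = 0, □ a box, q = p] -/
theorem lemma22Printed17Diag_cubeFam (hℓ : 1 ≤ ℓ) (a : ℝ) (ha : 0 < a) (Mb K : ℕ) :
    Lemma22Printed17Diag (cubeFam (d := d) ℓ m2plus a Mb K) := by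
  obtain ⟨c₂, hc, h⟩ := lemma22_17_diag_zero_box (d := d) (m2plus := m2plus) hℓ a ha
  exact ⟨c₂, 1, hc, one_pos, fun i _ _ _ _ _ _ s n μ f hs0 hs1 => h i n μ f s hs0 hs1⟩

/-- **THE DIAGONAL PART OF B4 LEMMA 2.2 IN THE CELL'S TYPED FORM, AT `Ã = 0` ON THE ZERO-FIELD BOX FAMILY.**
[cite: Balaban1983RegularityDecay, Lemma 2.2 (2.16)–(2.17) pp. 577–578, case Ã = 0, □ a box, q = p] -/
theorem lemma22PrintedDiag_cubeFam (hℓ : 1 ≤ ℓ) (a : ℝ) (ha : 0 < a) (Mb K : ℕ) :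
    Lemma22PrintedDiag (cubeFam (d := d) ℓ m2plus a Mb K) :=
  ⟨lemma22Printed16_cubeFam hℓ a ha Mb K, lemma22Printed17Diag_cubeFam hℓ a ha Mb K⟩

/-- AS TYPED, the (2.16)-clause on this family says exactly its THRESHOLD-FREE form `∀ α < 1, ∃ c₁ > 0, ∀ i,
fewLargeBlocks → ∀ f, ‖G_k(□,0)f‖_{1,α} ≤ c₁‖f‖_∞` (given `e₁`, every member is met again with the charge `e₁`,
same box, same sources; `rect`, `regular`, `constNearBdry` hold identically) — the typed threshold «for e
sufficiently small» is not what makes the clause true here. [folklore] -/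
theorem lemma22Printed16_cubeFam_iff_free (a : ℝ) (Mb K : ℕ) :
    Lemma22Printed16 (cubeFam (d := d) ℓ m2plus a Mb K) ↔
      ∀ α : ℝ, α < 1 → ∃ c₁ : ℝ, 0 < c₁ ∧ ∀ i : BoxInst d ℓ m2plus,
        (cubeFam ℓ m2plus a Mb K i).fewLargeBlocks →
        ∀ f : (cubeFam ℓ m2plus a Mb K i).Src,
          (cubeFam ℓ m2plus a Mb K i).holder1 α f ≤ c₁ * (cubeFam ℓ m2plus a Mb K i).supNorm f := by
  constructor
  · intro h α hα
    obtain ⟨c₁, e₁, hc, he, h⟩ := h α hα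
    refine ⟨c₁, hc, fun i hfew f => ?_⟩
    exact h { i with e := e₁ } (rectC a Mb K _) hfew trivial trivial he le_rfl f
  · intro h α hα
    obtain ⟨c₁, hc, h⟩ := h α hα
    exact ⟨c₁, 1, hc, one_pos, fun i _ hfew _ _ _ _ f => h i hfew f⟩

/-- likewise the diagonal (2.17)-clause on this family says exactly `∃ c₂ > 0, ∀ i, fewLargeBlocks → ∀ s ∈ [0,1],
∀ k μ f, ‖Y_k f‖_{1/s} ≤ c₂‖f‖_{1/s}` (the antecedent `fewLargeBlocks` is a genuine restriction on the member and
stays; `lemma22_17_diag_zero_box` proves the clause WITHOUT it). [folklore] -/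
theorem lemma22Printed17Diag_cubeFam_iff_free (a : ℝ) (Mb K : ℕ) :
    Lemma22Printed17Diag (cubeFam (d := d) ℓ m2plus a Mb K) ↔
      ∃ c₂ : ℝ, 0 < c₂ ∧ ∀ i : BoxInst d ℓ m2plus,
        (cubeFam ℓ m2plus a Mb K i).fewLargeBlocks →
        ∀ (s : ℝ) (n : Fin 3) (μ : (cubeFam ℓ m2plus a Mb K i).Dir) (f : (cubeFam ℓ m2plus a Mb K i).Src),
          0 ≤ s → s ≤ 1 → (cubeFam ℓ m2plus a Mb K i).opLq n μ s f ≤ c₂ * (cubeFam ℓ m2plus a Mb K i).lpNorm s f := by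
  constructor
  · rintro ⟨c₂, e₁, hc, he, h⟩
    refine ⟨c₂, hc, fun i hfew s n μ f hs0 hs1 => ?_⟩
    exact h { i with e := e₁ } (rectC a Mb K _) hfew trivial trivial he le_rfl s n μ f hs0 hs1
  · rintro ⟨c₂, hc, h⟩
    exact ⟨c₂, 1, hc, one_pos, fun i _ hfew _ _ _ _ s n μ f hs0 hs1 => h i hfew s n μ f hs0 hs1⟩

end Typed

/-! ## §8 Non-vacuity: every typed antecedent is met at every scale; the statements are instantiated -/

section NonVacuity

variable {ℓ : ℕ} {m2plus : ℝ}

/-- NON-VACUITY AT EVERY SCALE AND EVERY THRESHOLD: for every `e₁ > 0`, `Mb ≥ 1`, `K ≥ 1` and every `k ≥ 1` the member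
«the cube `[0, Mb)^{d+1}` of ONE large block, mass `0`, charge `e₁`» (node 12's `BoxInst.cube`) meets ALL SIX typed
antecedents of `Lemma22Printed` — `rect`, `fewLargeBlocks` (one label, `B4Lemma21Zero.blk_cubeInst_eq_zero`),
`regular`, `constNearBdry`, `0 < e ≤ e₁` — so neither the threshold «for e sufficiently small» nor «few large
blocks» excludes any mesh `η = L^{-k}`: the uniformity in `k` certified above is exercised. [folklore] -/
theorem cube_hypothesesC (hm2 : 0 ≤ m2plus) (a : ℝ) {Mb K : ℕ} (hMb : 1 ≤ Mb) (hK : 1 ≤ K) (k : ℕ) (hk : 1 ≤ k)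
    {e₁ : ℝ} (he : 0 < e₁) :
    (cubeFam ℓ m2plus a Mb K (BoxInst.cube (d := d) ℓ hm2 k hk Mb hMb e₁)).rect ∧
      (cubeFam ℓ m2plus a Mb K (BoxInst.cube (d := d) ℓ hm2 k hk Mb hMb e₁)).fewLargeBlocks ∧
      (cubeFam ℓ m2plus a Mb K (BoxInst.cube (d := d) ℓ hm2 k hk Mb hMb e₁)).regular ∧
      (cubeFam ℓ m2plus a Mb K (BoxInst.cube (d := d) ℓ hm2 k hk Mb hMb e₁)).constNearBdry ∧
      0 < (cubeFam ℓ m2plus a Mb K (BoxInst.cube (d := d) ℓ hm2 k hk Mb hMb e₁)).e ∧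
      (cubeFam ℓ m2plus a Mb K (BoxInst.cube (d := d) ℓ hm2 k hk Mb hMb e₁)).e ≤ e₁ := by
  have hL : 1 ≤ (ℓ + 1) ^ k := BoxInst.one_le_Lk ℓ k
  have hMn : 1 ≤ Mb * (ℓ + 1) ^ k := Nat.one_le_iff_ne_zero.mpr (Nat.mul_ne_zero (by omega) (by omega))
  refine ⟨rectC a Mb K _, ⟨?_, ?_⟩, trivial, trivial, he, le_rfl⟩
  · -- a union of large blocks
    have h := boxDom_isBlockUnion (d := d) hMn fun _ => 1
    have e : (fun _ : Fin (d + 1) => Mb * (ℓ + 1) ^ k * 1) = fun _ : Fin (d + 1) => (ℓ + 1) ^ k * Mb := by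
      funext; ring
    rw [e] at h
    exact h
  · -- exactly one large-block label
    show ((boxDom fun _ : Fin (d + 1) => (ℓ + 1) ^ k * Mb).image (blk (Mb * (ℓ + 1) ^ k))).card ≤ K
    calc ((boxDom fun _ : Fin (d + 1) => (ℓ + 1) ^ k * Mb).image (blk (Mb * (ℓ + 1) ^ k))).card
        ≤ ({(0 : Fin (d + 1) → ℤ)} : Finset (Fin (d + 1) → ℤ)).card := by
          apply Finset.card_le_card
          intro y hy
          rw [Finset.mem_image] at hy
          obtain ⟨x, hx, rfl⟩ := hy
          rw [Finset.mem_singleton]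
          exact blk_cubeInst_eq_zero hx
      _ = 1 := Finset.card_singleton _
      _ ≤ K := hK

/-- hence, for every threshold `e₁ > 0` and every scale `k ≥ 1`, SOME member meets all six antecedents (pattern of
`B4Lemma21Zero.threshold_met`). [folklore] -/
theorem threshold_metC (hm2 : 0 ≤ m2plus) (a : ℝ) {Mb K : ℕ} (hMb : 1 ≤ Mb) (hK : 1 ≤ K) (k : ℕ) (hk : 1 ≤ k)
    {e₁ : ℝ} (he : 0 < e₁) :
    ∃ i : BoxInst d ℓ m2plus, i.k = k ∧ (cubeFam ℓ m2plus a Mb K i).rect ∧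
      (cubeFam ℓ m2plus a Mb K i).fewLargeBlocks ∧ (cubeFam ℓ m2plus a Mb K i).regular ∧
      (cubeFam ℓ m2plus a Mb K i).constNearBdry ∧ 0 < (cubeFam ℓ m2plus a Mb K i).e ∧
      (cubeFam ℓ m2plus a Mb K i).e ≤ e₁ :=
  ⟨BoxInst.cube ℓ hm2 k hk Mb hMb e₁, rfl, cube_hypothesesC hm2 a hMb hK k hk he⟩

/-- the certified typed statement instantiated: `d + 1 = 4`, `L = 2`, `m²₊ = 1`, `a = 1`, `Mb = 5`, `K = 1`.
[folklore] -/
example : Lemma22PrintedDiag (cubeFam (d := 3) 1 1 1 5 1) :=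
  lemma22PrintedDiag_cubeFam le_rfl 1 one_pos 5 1

/-- and its index type is inhabited by a member meeting every antecedent: scale `k = 3` (`η = 1/8`), the cube of one
large block of size `5`, charge `1/2 ≤ e₁ := 1/2`. [folklore] -/
example : ∃ i : BoxInst 3 1 1, i.k = 3 ∧ (cubeFam 1 1 1 5 1 i).rect ∧ (cubeFam 1 1 1 5 1 i).fewLargeBlocks ∧
    (cubeFam 1 1 1 5 1 i).regular ∧ (cubeFam 1 1 1 5 1 i).constNearBdry ∧ 0 < (cubeFam 1 1 1 5 1 i).e ∧
    (cubeFam 1 1 1 5 1 i).e ≤ 1 / 2 :=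
  threshold_metC zero_le_one 1 (by norm_num) le_rfl 3 (by norm_num) (by norm_num)

end NonVacuity

end

end Literature.MathematicalPhysics.QuantumFieldTheory.Balaban1983to89.B4Lemma22ZeroBoxCube
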